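/-
Copyright (c) 2026 the pub-hodgecm-mathlib formalisation cell (harness21).  Prover seat hodgecm-mathlib-LH4-p09 (g8), req620 Track A «(D-RAM) FOUR-FRAME» squad
(heir dealer LH4-plan (g13) WORD #58 RULING C — (T-G-on) organs, discharged at the token of record).  2026-09-04.
-/
import Summits.HodgeConjecture.HodgeConjecture.Theorems.F0P3cDyRamLabelledKappaCoreHangingLocusClosed   -- ★ p859777 (this seat) K3; brings K2 ★ p859740 (vacuous + R-currency), ★ κH socket
import Summits.HodgeConjecture.HodgeConjecture.Theorems.F0P3cDyRamLabelledKappaGluedLocus                -- ★ p859791 (this seat) K4 (G1 vacuous); brings ★ κG1 socket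
import HarnessLib

/-!
# (D-RAM) four-frame, STAGE 1b — (S2b-κS) organs DISCHARGED AT THE TOKEN OF RECORD `D₂ = diag((α−1)², (β−1)², 0)`: the on-locus glued ∕ core-hanging
# labelled κ-cells that the labelled trunk (★ p859650 `hTrunk`) actually meets — H on an equal-depth datum (always on-locus), G1 on the locus `n₁ = n₂ + t′`

Helper brick for dealer LH4-plan (g13) WORD #58 RULING C ((T-G-on) = this seat) and LH4-p12 (g7)'s (T-box) «on-locus cells enter as NAMED LETTERS + hypotheses p09's
closed forms discharge»: here are the discharges, hypothesis-free except the level guard `ℓ ≤ 2ρ` (true for the levels of record `lb d ≤ 2 ≤ 2ρ`).  `Theorems/` only,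
statement-first, ★-only imports, lane `--supports stmt-HodgeConjecture-24833 --as helper`; it PAYS NO tier-0 row (count-neutral).

THE TOKEN OF RECORD.  `e = ((α−1)², (β−1)², 0)`: `v(e₂−e₀) = 2n₂`, `v(e₂−e₁) = 2n₁`, `g_e = g₀²` (§1).  Hence:
* H on an equal-depth datum `n₁ = n₂` is ALWAYS on the locus with `k = 2n₂ ≥ 2ρ`-ish; on the EQUILATERAL FOOT (`n₁ = n₂ = n₃ = m`, `ρ ≤ m < 2ρ`) the genuine
  regime `2m < ℓ + 2ρ` has NO common fixed witness (the centres `−g₀`, `−g₀²` are at distance `|g₀|·|1−g₀| = 1`, ★ `v_glueUnit_letters`) ⇒ §2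
  **`finsum_kappaCount_mul_stabiliserWeight_stratum_H_sep_sqToken_foot`**: `= [reads] · ([ℓ + 2ρ ≤ 2m] · ★ κH value)` — vacuous ⇒ ★ κH (K2), genuine ⇒ `0` (K3).
* H TUBE with `n₁ = n₂` (`2ρ ≤ n₂`, `ρ ≤ n₃`) and `ℓ ≤ 2ρ`: `k = 2n₂ ≥ 4ρ ≥ ℓ + 2ρ` ⇒ vacuous ⇒ §2 **`…_H_sep_sqToken_tube`** `= [reads] · ★ κH value`.
* G1 TUBE on the locus `n₁ = n₂ + t′` (`2ρ + 2t′ ≤ n₁`, `2ρ ≤ n₂`) and `ℓ ≤ 2ρ`: vacuous, and the reads hold ⇒ §3 **`…_G1_sep_sqToken_tube`** `= ★ κG1 value` outright.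
The one symbolic letter left in the H reads is `|(β−1)² − (α−1)²| ≤ |ϖ|^{ℓ+ρ}` (`= |ϖ|^{n₃}·|α+β−2|`, a possible cancellation at `n₁ = n₂` — not asserted).

HONEST LABEL: helper organs for a HYPOTHESIS; STAGE-1b tier-0 rows T₊∕T₋∕regular and the six ED. 5 stubs stay OPEN; HC_CM is proved only modulo the 7 printed
citations (2 remaining named inputs: hLiu418 = `stmt-HodgeConjecture-24832`, h413 = `stmt-HodgeConjecture-24833`) until rung 0 closes.

## References
* [Kottwitz1986BaseChangeUnits] R. E. Kottwitz, *Base change for unit elements of Hecke algebras*, Compositio Math. 60 (1986), §1 pp. 240–241 (κ-orbital integrals of units as signed lattice counts modulo the torus).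
* [LanglandsShelstad1987] R. P. Langlands, D. Shelstad, *On the definition of transfer factors*, Math. Ann. 278 (1987), §3 (κ as a character).
* [Rogawski1990] J. D. Rogawski, *Automorphic Representations of Unitary Groups in Three Variables*, Ann. of Math. Stud. 123 (1990), §4.9 Prop. 4.9.1 (a)(b) p. 55.
-/

set_option autoImplicit false

noncomputable section

namespace Summit.HodgeConjecture.HodgeConjecture.Cruxes.H413.F0P3cDyRamLabelledKappaSqTokenCells

open Matrix WithZero
open Literature.NumberTheory.Automorphic Literature.NumberTheory.Automorphic.HermitianLattice Literature.NumberTheory.Automorphic.UnitaryGroup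
open Literature.NumberTheory.Automorphic.UnitaryLatticeTree Literature.NumberTheory.Automorphic.UnitaryThreeFourFrame
open Literature.NumberTheory.LocalFields.WildQuadraticDatum
open Summit.HodgeConjecture.HodgeConjecture.Cruxes.H413.F0P3cDyRamDiagonalTorusDefs
open Summit.HodgeConjecture.HodgeConjecture.Cruxes.H413.F0P3cDyRamDiagonalStrataDefs
open Summit.HodgeConjecture.HodgeConjecture.Cruxes.H413.F0P3cDyRamDiagonalKappaCountDefs
open Summit.HodgeConjecture.HodgeConjecture.Cruxes.H413.F0P3cDyRamDiagonalGluedStabiliserIndex (ne_zero_and_v_lt_one_of_v_eq_exp)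
open Summit.HodgeConjecture.HodgeConjecture.Cruxes.H413.F0P3cDyRamDiagonalGluedClassRepresentatives (exists_fixed_class_representatives)
open Summit.HodgeConjecture.HodgeConjecture.Cruxes.H413.F0P3cDyRamDiagonalKappaCoreHangingSocket (v_glueUnit_letters)
open Summit.HodgeConjecture.HodgeConjecture.Cruxes.H413.F0P3cDyRamElementDatumParity (isoceles_of_isElementDatum)
open Summit.HodgeConjecture.HodgeConjecture.Cruxes.H413.F0P3cDyRamFourFrameCensusDefs
open Summit.HodgeConjecture.HodgeConjecture.Cruxes.H413.F0P3cDyRamLabelledKappaCoreHangingLocus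
open Summit.HodgeConjecture.HodgeConjecture.Cruxes.H413.F0P3cDyRamLabelledKappaCoreHangingLocusClosed
open Summit.HodgeConjecture.HodgeConjecture.Cruxes.H413.F0P3cDyRamLabelledKappaGluedLocus
open scoped Valued WithZero Matrix MatrixGroups

/-! ## §1  The valuation letters of the token of record -/

section Data

variable {K : Type*} [Field K] [Valued K ℤᵐ⁰]

omit [Valued K ℤᵐ⁰] in
/-- `g_e = ((β−1)∕(α−1))²` for `e = ((α−1)², (β−1)², 0)`. [cite: Kottwitz1986BaseChangeUnits, §1 pp. 240–241] -/
theorem glueRatio_sqToken_eq (α β : K) :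
    ((![(α - 1) * (α - 1), (β - 1) * (β - 1), 0] : Fin 3 → K) 2 - (![(α - 1) * (α - 1), (β - 1) * (β - 1), 0] : Fin 3 → K) 1) /
        ((![(α - 1) * (α - 1), (β - 1) * (β - 1), 0] : Fin 3 → K) 2 - (![(α - 1) * (α - 1), (β - 1) * (β - 1), 0] : Fin 3 → K) 0) =
      ((β - 1) / (α - 1)) * ((β - 1) / (α - 1)) := by
  simp only [Matrix.cons_val_zero, Matrix.cons_val_one, Matrix.cons_val_two, Matrix.tail_cons, Matrix.head_cons, zero_sub]
  rw [neg_div_neg_eq, div_mul_div_comm]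

/-- The differences of the token of record: `v(e₂−e₀) = 2n₂`, `v(e₂−e₁) = 2n₁`. [cite: Kottwitz1986BaseChangeUnits, §1 pp. 240–241] -/
theorem sqToken_differences {ϖ α β : K} {n₁ n₂ : ℕ} (h₁ : Valued.v (β - 1) = Valued.v ϖ ^ n₁) (h₂ : Valued.v (α - 1) = Valued.v ϖ ^ n₂) :
    Valued.v ((![(α - 1) * (α - 1), (β - 1) * (β - 1), 0] : Fin 3 → K) 2 - (![(α - 1) * (α - 1), (β - 1) * (β - 1), 0] : Fin 3 → K) 0) =
        Valued.v ϖ ^ (2 * n₂) ∧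
      Valued.v ((![(α - 1) * (α - 1), (β - 1) * (β - 1), 0] : Fin 3 → K) 2 - (![(α - 1) * (α - 1), (β - 1) * (β - 1), 0] : Fin 3 → K) 1) =
        Valued.v ϖ ^ (2 * n₁) := by
  simp only [Matrix.cons_val_zero, Matrix.cons_val_one, Matrix.cons_val_two, Matrix.tail_cons, Matrix.head_cons, zero_sub, Valuation.map_neg, map_mul,
    h₁, h₂, ← pow_add, two_mul, and_self]

/-- **NO COMMON FIXED WITNESS AT THE TOKEN OF RECORD ON AN EQUILATERAL DATUM**: with `|g₀| = |1 − g₀| = 1` no `f` can lie in both a ball of radius `< 1` around `−g₀`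
and one around `−g₀²` (their centres are at distance `|g₀|·|1−g₀| = 1`). [cite: Kottwitz1986BaseChangeUnits, §1 pp. 240–241] -/
theorem not_exists_common_witness_sq {ϖ : K} (hϖ1 : Valued.v ϖ < 1) {g₀ : K} (hg₀ : Valued.v g₀ = 1) (h1g₀ : Valued.v (1 - g₀) = 1) {e₀ E : ℕ}
    (he₀ : 1 ≤ e₀) (hE : 1 ≤ E) (P : K → Prop) :
    ¬ ∃ f : K, P f ∧ Valued.v (f + g₀) ≤ Valued.v ϖ ^ e₀ ∧ Valued.v (f + g₀ * g₀) ≤ Valued.v ϖ ^ E := by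
  rintro ⟨f, -, hf₀, hf₁⟩
  have h : Valued.v ((f + g₀) - (f + g₀ * g₀)) < 1 :=
    (Valuation.map_sub _ _ _).trans_lt (max_lt (hf₀.trans_lt (pow_lt_one₀ zero_le hϖ1 (by omega))) (hf₁.trans_lt (pow_lt_one₀ zero_le hϖ1 (by omega))))
  rw [show (f + g₀) - (f + g₀ * g₀) = g₀ * (1 - g₀) by ring, map_mul, hg₀, h1g₀, mul_one] at h
  exact lt_irrefl _ h

end Data

/-! ## §2  H at the token of record -/

section CoreHanging

variable {K : Type} [Field K] [Valued K ℤᵐ⁰] [CompleteSpace K] [Fintype 𝓀[K]] {σ : K →+* K} {ϖ : K} {d t : ℕ} {α β : K} {N₀ n₁ n₂ n₃ : ℕ}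
  {T : GL (Fin 3) K}

open Classical in
/-- **HEAD — LABELLED κ-WEIGHTED H SUM AT THE TOKEN OF RECORD, EQUILATERAL FOOT** (`n₁ = n₂ = n₃ = m`, `ρ ≤ m < 2ρ`; level `ℓ`): with
`reads = (2n ≥ ℓ-type conjuncts) ∧ |(β−1)² − (α−1)²| ≤ |ϖ|^{ℓ+ρ} ∧ ℓ + ρ ≤ 2m`:
`Σᶠ_{M ∈ H(2ρ,2ρ,2ρ), D₂M ⊆ ϖ^ℓM} κᵢ(M)·w(M) = [reads] · [ℓ + 2ρ ≤ 2m] · (★ κH value)` — vacuous ⇒ K2, genuine ⇒ `0` by K3 (no common witness, §1).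
[cite: Kottwitz1986BaseChangeUnits, §1 pp. 240–241] [cite: LanglandsShelstad1987, §3] [cite: Rogawski1990, §4.9 Prop. 4.9.1 (a)(b) p. 55] -/
theorem finsum_kappaCount_mul_stabiliserWeight_stratum_H_sep_sqToken_foot (hD : IsRamifiedQuadraticDatum σ ϖ d t) (h2 : Valued.v (2 : K) < 1)
    (hE : IsElementDatum σ ϖ N₀ α β n₁ n₂ n₃) (hN₀ : d ≤ N₀) (hT : (T : Matrix (Fin 3) (Fin 3) K) = Matrix.diagonal ![α, β, 1])
    (ρ : ℕ) (hρ : 1 ≤ ρ) (h12 : n₁ = n₂) (h13 : n₁ = n₃) (hρm : ρ ≤ n₁) (hm : n₁ < 2 * ρ) (i : Fin 3) (f₀ : K) (hσf₀ : σ f₀ = f₀)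
    (hf₀ : n₁ = n₂ → n₂ = n₃ → n₁ < 2 * ρ → 2 * ρ - n₁ ≤ n₁ - d + 1 → Valued.v (f₀ + (β - 1) / (α - 1)) ≤ Valued.v ϖ ^ (2 * ρ - n₁)) (ℓ : ℕ) :
    ∑ᶠ M ∈ {M | M ∈ stratum σ ϖ T ![2 * ρ, 2 * ρ, 2 * ρ] ∧
        LatticeInLevel ϖ ℓ (Matrix.diagonal ![(α - 1) * (α - 1), (β - 1) * (β - 1), 0]) M}, (kappaCount σ ϖ 0 i M : ℚ) * stabiliserWeight σ M =
      if ((Valued.v ((α - 1) * (α - 1)) ≤ Valued.v ϖ ^ ℓ ∧ Valued.v ((β - 1) * (β - 1)) ≤ Valued.v ϖ ^ ℓ ∧ Valued.v (0 : K) ≤ Valued.v ϖ ^ ℓ) ∧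
          Valued.v ((β - 1) * (β - 1) - (α - 1) * (α - 1)) ≤ Valued.v ϖ ^ (ℓ + ρ)) ∧ ℓ + ρ ≤ 2 * n₁ then
        (if ℓ + 2 * ρ ≤ 2 * n₁ then
          (if n₁ = n₂ ∧ n₂ = n₃ ∧ n₁ < 2 * ρ ∧ 2 * ρ - n₁ ≤ n₁ - d + 1 ∧ d ≤ (2 * ρ - n₁ + 1) / 2
            then (((![normSign σ (-(1 + f₀)), normSign σ f₀ * normSign σ (-(1 + f₀)), normSign σ f₀] : Fin 3 → ℤ) i : ℤ) : ℚ) *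
              (Fintype.card 𝓀[K] : ℚ) ^ (2 * ρ - (2 * ρ - n₁ + 1) / 2)
            else 0)
          else 0)
      else 0 := by
  classical
  subst h12
  obtain ⟨hσ, hvσ, hϖ, hfix, hd, -, -⟩ := id hD
  obtain ⟨-, -, -, -, -, h₁, h₂, h₃, -, -, -⟩ := id hE
  obtain ⟨hϖ0, hϖ1⟩ := ne_zero_and_v_lt_one_of_v_eq_exp hϖ
  obtain ⟨hk, hloc⟩ := sqToken_differences h₁ h₂
  have hread0 : (![(α - 1) * (α - 1), (β - 1) * (β - 1), 0] : Fin 3 → K) 0 = (α - 1) * (α - 1) := rfl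
  have hread1 : (![(α - 1) * (α - 1), (β - 1) * (β - 1), 0] : Fin 3 → K) 1 = (β - 1) * (β - 1) := rfl
  have hread2 : (![(α - 1) * (α - 1), (β - 1) * (β - 1), 0] : Fin 3 → K) 2 = 0 := rfl
  by_cases hout : ((Valued.v ((α - 1) * (α - 1)) ≤ Valued.v ϖ ^ ℓ ∧ Valued.v ((β - 1) * (β - 1)) ≤ Valued.v ϖ ^ ℓ ∧ Valued.v (0 : K) ≤ Valued.v ϖ ^ ℓ) ∧
      Valued.v ((β - 1) * (β - 1) - (α - 1) * (α - 1)) ≤ Valued.v ϖ ^ (ℓ + ρ)) ∧ ℓ + ρ ≤ 2 * n₁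
  · rw [if_pos hout]
    by_cases hvac : ℓ + 2 * ρ ≤ 2 * n₁
    · rw [if_pos hvac]
      exact finsum_kappaCount_mul_stabiliserWeight_stratum_H_sep_eq_of_vacuous hD h2 hE hN₀ hT ρ hρ i f₀ hσf₀ hf₀ ℓ (2 * n₁) _
        hk hloc (by rw [hread0, hread1, hread2]; exact hout.1) hvac
    · rw [if_neg hvac]
      have h₃' : Valued.v (β - α) = Valued.v ϖ ^ n₁ := by rw [Valuation.map_sub_swap, h13]; exact h₃
      obtain ⟨hg₀, h1g₀⟩ := v_glueUnit_letters hϖ0 h₁ h₂ h₃'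
      refine finsum_kappaCount_mul_stabiliserWeight_stratum_H_sep_onLocus_foot_of_no_witness hD h2 hE hT ρ hρ rfl h13 hρm hm i ℓ (2 * n₁) _
        hk hloc (by omega) ?_
      rw [glueRatio_sqToken_eq]
      exact not_exists_common_witness_sq hϖ1 hg₀ h1g₀ (by omega) (by omega) (fun f => σ f = f)
  · rw [if_neg hout]
    obtain ⟨R, hRfin, -, hR1, hR2, hR3⟩ := exists_fixed_class_representatives hσ hvσ hfix hϖ hd ρ 0 hρ
    simp only [Nat.mul_zero, pow_zero, Nat.add_zero] at hR1 hR2 hR3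
    rw [finsum_kappaCount_mul_stabiliserWeight_stratum_H_sep_onLocus_foot_eq hD h2 hE hT ρ hρ rfl h13 hρm hm i ℓ (2 * n₁) _
      hk hloc hRfin hR1 hR2 hR3, hread0, hread1, hread2, if_neg hout]

open Classical in
/-- **HEAD — LABELLED κ-WEIGHTED H SUM AT THE TOKEN OF RECORD, TUBE WITH `n₁ = n₂`** (`2ρ ≤ n₂`, `ρ ≤ n₃`; level `ℓ ≤ 2ρ`): `k = 2n₂ ≥ 4ρ ≥ ℓ + 2ρ` makes the
token ball vacuous, so the label-cut sum is `[reads] · (★ κH value)` (K2 `…_sep_eq_of_vacuous`; ★ κH's own value is `0` in the tube).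
[cite: Kottwitz1986BaseChangeUnits, §1 pp. 240–241] [cite: LanglandsShelstad1987, §3] [cite: Rogawski1990, §4.9 Prop. 4.9.1 (a)(b) p. 55] -/
theorem finsum_kappaCount_mul_stabiliserWeight_stratum_H_sep_sqToken_tube (hD : IsRamifiedQuadraticDatum σ ϖ d t) (h2 : Valued.v (2 : K) < 1)
    (hE : IsElementDatum σ ϖ N₀ α β n₁ n₂ n₃) (hN₀ : d ≤ N₀) (hT : (T : Matrix (Fin 3) (Fin 3) K) = Matrix.diagonal ![α, β, 1])
    (ρ : ℕ) (hρ : 1 ≤ ρ) (h12 : n₁ = n₂) (htube : 2 * ρ ≤ n₂) (hn₃ : ρ ≤ n₃) (i : Fin 3) (f₀ : K) (hσf₀ : σ f₀ = f₀)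
    (hf₀ : n₁ = n₂ → n₂ = n₃ → n₁ < 2 * ρ → 2 * ρ - n₁ ≤ n₁ - d + 1 → Valued.v (f₀ + (β - 1) / (α - 1)) ≤ Valued.v ϖ ^ (2 * ρ - n₁)) (ℓ : ℕ)
    (hℓ : ℓ ≤ 2 * ρ) :
    ∑ᶠ M ∈ {M | M ∈ stratum σ ϖ T ![2 * ρ, 2 * ρ, 2 * ρ] ∧
        LatticeInLevel ϖ ℓ (Matrix.diagonal ![(α - 1) * (α - 1), (β - 1) * (β - 1), 0]) M}, (kappaCount σ ϖ 0 i M : ℚ) * stabiliserWeight σ M =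
      if ((Valued.v ((α - 1) * (α - 1)) ≤ Valued.v ϖ ^ ℓ ∧ Valued.v ((β - 1) * (β - 1)) ≤ Valued.v ϖ ^ ℓ ∧ Valued.v (0 : K) ≤ Valued.v ϖ ^ ℓ) ∧
          Valued.v ((β - 1) * (β - 1) - (α - 1) * (α - 1)) ≤ Valued.v ϖ ^ (ℓ + ρ)) ∧ ℓ + ρ ≤ 2 * n₂ then
        (if n₁ = n₂ ∧ n₂ = n₃ ∧ n₁ < 2 * ρ ∧ 2 * ρ - n₁ ≤ n₁ - d + 1 ∧ d ≤ (2 * ρ - n₁ + 1) / 2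
          then (((![normSign σ (-(1 + f₀)), normSign σ f₀ * normSign σ (-(1 + f₀)), normSign σ f₀] : Fin 3 → ℤ) i : ℤ) : ℚ) *
            (Fintype.card 𝓀[K] : ℚ) ^ (2 * ρ - (2 * ρ - n₁ + 1) / 2)
          else 0)
      else 0 := by
  classical
  obtain ⟨hσ, hvσ, hϖ, hfix, hd, -, -⟩ := id hD
  obtain ⟨-, -, -, -, -, h₁, h₂, h₃, -, -, -⟩ := id hE
  obtain ⟨hk, hloc⟩ := sqToken_differences h₁ h₂
  rw [h12] at hloc
  have hread0 : (![(α - 1) * (α - 1), (β - 1) * (β - 1), 0] : Fin 3 → K) 0 = (α - 1) * (α - 1) := rfl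
  have hread1 : (![(α - 1) * (α - 1), (β - 1) * (β - 1), 0] : Fin 3 → K) 1 = (β - 1) * (β - 1) := rfl
  have hread2 : (![(α - 1) * (α - 1), (β - 1) * (β - 1), 0] : Fin 3 → K) 2 = 0 := rfl
  by_cases hout : ((Valued.v ((α - 1) * (α - 1)) ≤ Valued.v ϖ ^ ℓ ∧ Valued.v ((β - 1) * (β - 1)) ≤ Valued.v ϖ ^ ℓ ∧ Valued.v (0 : K) ≤ Valued.v ϖ ^ ℓ) ∧
      Valued.v ((β - 1) * (β - 1) - (α - 1) * (α - 1)) ≤ Valued.v ϖ ^ (ℓ + ρ)) ∧ ℓ + ρ ≤ 2 * n₂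
  · rw [if_pos hout]
    exact finsum_kappaCount_mul_stabiliserWeight_stratum_H_sep_eq_of_vacuous hD h2 hE hN₀ hT ρ hρ i f₀ hσf₀ hf₀ ℓ (2 * n₂) _ hk hloc
      (by rw [hread0, hread1, hread2]; exact hout.1) (by omega)
  · rw [if_neg hout]
    obtain ⟨R, hRfin, -, hR1, hR2, hR3⟩ := exists_fixed_class_representatives hσ hvσ hfix hϖ hd ρ 0 hρ
    simp only [Nat.mul_zero, pow_zero, Nat.add_zero] at hR1 hR2 hR3
    rw [finsum_kappaCount_mul_stabiliserWeight_stratum_H_sep_onLocus_tube_eq hD h2 hE hT ρ hρ ⟨by omega, htube⟩ hn₃ i ℓ (2 * n₂) _ hk hloc hRfin hR1 hR2 hR3,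
      hread0, hread1, hread2, if_neg hout]

end CoreHanging

/-! ## §3  G1 at the token of record, on the locus `n₁ = n₂ + t′` (tube) -/

section Glued

variable {K : Type} [Field K] [Valued K ℤᵐ⁰] [CompleteSpace K] [Fintype 𝓀[K]] {σ : K →+* K} {ϖ : K} {d t : ℕ} {α β : K} {N₀ n₁ n₂ n₃ : ℕ}
  {T : GL (Fin 3) K}

/-- **HEAD — LABELLED κ-WEIGHTED G1 SUM AT THE TOKEN OF RECORD ON ITS LOCUS `n₁ = n₂ + t′`, TUBE** (`2ρ + 2t′ ≤ n₁`, `2ρ ≤ n₂`; level `ℓ ≤ 2ρ`): the reads hold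
(`ℓ ≤ 2ρ ≤ 2n₂ ≤ 2n₁`, `ℓ + ρ ≤ 4ρ ≤ 2n₂`) and the token ball is vacuous (`ℓ + 2ρ ≤ 4ρ ≤ 2n₂ = k`), so the label-cut sum IS ★ κG1's value (K4 `…_sep_eq_of_vacuous`).
[cite: Kottwitz1986BaseChangeUnits, §1 pp. 240–241] [cite: LanglandsShelstad1987, §3] [cite: Rogawski1990, §4.9 Prop. 4.9.1 (a)(b) p. 55] -/
theorem finsum_kappaCount_mul_stabiliserWeight_stratum_G1_sep_sqToken_tube (hD : IsRamifiedQuadraticDatum σ ϖ d t) (h2 : Valued.v (2 : K) < 1)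
    (hE : IsElementDatum σ ϖ N₀ α β n₁ n₂ n₃) (hN₀ : d ≤ N₀) (hT : (T : Matrix (Fin 3) (Fin 3) K) = Matrix.diagonal ![α, β, 1])
    (ρ t' : ℕ) (hρ : 1 ≤ ρ) (ht' : 1 ≤ t') (hloc : n₁ = n₂ + t') (htube : 2 * ρ + 2 * t' ≤ n₁ ∧ 2 * ρ ≤ n₂) (i : Fin 3) (f₀ : K) (hf₀ : σ f₀ = f₀)
    (hglue : 2 ∣ 2 * t' → n₂ = n₃ → n₁ = n₂ + 2 * t' → n₂ < 2 * ρ → 2 * ρ - n₂ ≤ n₂ - d + 1 →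
      Valued.v (f₀ + (β - 1) / (α - 1)) ≤ Valued.v ϖ ^ (2 * ρ + 2 * t' - n₂)) (ℓ : ℕ) (hℓ : ℓ ≤ 2 * ρ) :
    ∑ᶠ M ∈ {M | M ∈ stratum σ ϖ T ![2 * ρ, 2 * ρ + 2 * t', 2 * ρ + 2 * t'] ∧
        LatticeInLevel ϖ ℓ (Matrix.diagonal ![(α - 1) * (α - 1), (β - 1) * (β - 1), 0]) M}, (kappaCount σ ϖ 0 i M : ℚ) * stabiliserWeight σ M =
      (if 2 ∣ 2 * t' ∧ 2 * ρ ≤ min n₂ n₃ ∧ 2 * ρ + 2 * t' ≤ n₁ then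
          (![(normSign σ (-1 : K) : ℚ) * (Fintype.card 𝓀[K] : ℚ) ^ (2 * ρ + 2 * t' / 2 - 1) *
              ((if 2 * d ≤ 2 * t' then (Fintype.card 𝓀[K] : ℚ) - 1 else 0) - (if 2 * t' + 2 = 2 * d then 1 else 0)), 0, 0] : Fin 3 → ℚ) i
        else 0) +
      (if 2 ∣ 2 * t' ∧ n₂ = n₃ ∧ n₁ = n₂ + 2 * t' ∧ n₂ < 2 * ρ ∧ 2 * ρ - n₂ ≤ n₂ - d + 1 then
          (![if 2 * d ≤ 2 * t' + 2 * ((2 * ρ - n₂ + 1) / 2) then (normSign σ (-1 : K) : ℚ) * normSign σ (1 + f₀) else 0,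
             if d ≤ (2 * ρ - n₂ + 1) / 2 then (normSign σ (-1 : K) : ℚ) * normSign σ f₀ * normSign σ (1 + f₀) else 0,
             if d ≤ (2 * ρ - n₂ + 1) / 2 then (normSign σ f₀ : ℚ) else 0] : Fin 3 → ℚ) i *
            (Fintype.card 𝓀[K] : ℚ) ^ (2 * ρ + 2 * t' / 2 - (2 * ρ - n₂ + 1) / 2)
        else 0) := by
  classical
  have hϖ : Valued.v ϖ = exp (-1 : ℤ) := hD.2.2.1
  obtain ⟨-, -, -, -, -, h₁, h₂, -, -, -, -⟩ := id hE
  obtain ⟨hk, hloc'⟩ := sqToken_differences h₁ h₂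
  rw [hloc, show 2 * (n₂ + t') = 2 * n₂ + 2 * t' by ring] at hloc'
  have hp : ∀ m n : ℕ, Valued.v ϖ ^ m ≤ Valued.v ϖ ^ n ↔ n ≤ m := fun m n => UnitaryLatticeTree.v_pow_le_v_pow_iff hϖ m n
  have hout : (Valued.v ((![(α - 1) * (α - 1), (β - 1) * (β - 1), 0] : Fin 3 → K) 0) ≤ Valued.v ϖ ^ ℓ ∧
      Valued.v ((![(α - 1) * (α - 1), (β - 1) * (β - 1), 0] : Fin 3 → K) 1) ≤ Valued.v ϖ ^ ℓ ∧
      Valued.v ((![(α - 1) * (α - 1), (β - 1) * (β - 1), 0] : Fin 3 → K) 2) ≤ Valued.v ϖ ^ ℓ) ∧ ℓ + ρ ≤ 2 * n₂ := by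
    simp only [Matrix.cons_val_zero, Matrix.cons_val_one, Matrix.cons_val_two, Matrix.tail_cons, Matrix.head_cons, map_mul, map_zero, h₁, h₂,
      ← pow_add, hp]
    exact ⟨⟨by omega, by omega, zero_le⟩, by omega⟩
  exact finsum_kappaCount_mul_stabiliserWeight_stratum_G1_sep_eq_of_vacuous hD h2 hE hN₀ hT ρ t' hρ ht' i f₀ hf₀ hglue ℓ (2 * n₂) _ hk hloc' hout (by omega)

end Glued

end Summit.HodgeConjecture.HodgeConjecture.Cruxes.H413.F0P3cDyRamLabelledKappaSqTokenCells

end
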